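import Summits.BirchSwinnertonDyer.BirchSwinnertonDyer.Theses.ResidualThetaTransportAtTwo
import Summits.BirchSwinnertonDyer.BirchSwinnertonDyer.Theorems.ThetaPartnerAtTwoSignedTransportAtTwoRlfLambdaOfPrint
import Summits.BirchSwinnertonDyer.BirchSwinnertonDyer.Theorems.ThetaPartnerAtTwoSignedMainConjectureCMTwoRankZeroOfLocal
import HarnessLib

/-!
# RLF `ResidualLambdaFormulaNegDiscAtTwo` (stmt-BirchSwinnertonDyer-23110, routes `ResidualThetaTransportAtTwo` r201 /
# `ThetaPartnerAtTwo`) RESTRICTED TO ANALYTIC RANK `0` is print: certificate for a restatement (seat bsd-wall-rtt-p2 g8;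
# `--supports`; closes nothing)

THEOREMS ONLY; no definition; BSD is not proved by any of this. The uniform-family residual λ-formula 23110 quantifies over
globally minimal `E/ℚ` (good supersingular at `2`, `a₂ = 0`, `Δ < 0`, bad places in `S₀`) of EVERY rank. Its only consumers
instantiate it at curves of analytic rank `0` (RTT: the habitat curve `W`, see `…ResidualThetaLayer.residualThetaMainConjectureAtTwo_of_residualLower`;
TPT: the pair `(W, A)` of K1Ar, `SignedTransportAtTwo.signedTransportAtTwo_rankZero_of_print4`). At analytic rank `0`,
`Sel_{2^∞}(E/ℚ)` is finite (Gross–Zagier–Kolyvagin, route item `RankEqAnalyticRankLeOne` 19921) and the formula WITH `c = 0` is the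
landed print road `SignedTransportAtTwo.rlf2_of_print4` (tp2-p1 g8) modulo conjuncts 1, 2, 3, 5 of route item
`PublishedInputsGreenbergControlAtTwo` (24143). Hence:

* `residualLambdaFormulaNegDiscAtTwo_rankZero_of_pub` : PUB-G → GZK → ⟨23110's text with `E.analyticRank = 0 →` inserted after
  `E.Δ < 0 →`, VERBATIM otherwise⟩ (witness `c = 0`).

The positive-rank members (Greenberg–Vatsal Prop. (2.1) / B. D. Kim's no-finite-submodule theorem for the signed Selmer group at `2`,
cotorsion-only) are unprinted, not in the tree, and consumed by nothing.
References: [GreenbergVatsal2000] §2 Prop. (2.1), (2.4), (10); [BDKim2013] Thm. 1.1; [GreenbergLNM1716] Props. 4.12–4.15;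
[Kolyvagin1990] Thm. A; [GrossZagier1986] Thm. I.6.3.
-/

set_option autoImplicit false
-- D-0017: single-problem summit, so `Summit.BirchSwinnertonDyer.BirchSwinnertonDyer.…` repeats a namespace BY DESIGN.
set_option linter.dupNamespace false

noncomputable section

open scoped Classical

namespace Summit.BirchSwinnertonDyer.BirchSwinnertonDyer.Theorems.ResidualThetaLayer

/-- **23110 at analytic rank `0`, from print.** Text = route decl `ResidualLambdaFormulaNegDiscAtTwo` with the single binder
`E.analyticRank = 0 →` inserted after `E.Δ < 0 →`; proved with the uniform constant `c = 0` from
`SignedTransportAtTwo.rlf2_of_print4` (PUB⁴) and `finite_selmerGroupPInfty_two_of_analyticRank_eq_zero` (GZK).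
[cite: GreenbergVatsal2000, Prop. 2.8 and (10)] [cite: GreenbergLNM1716, Props. 4.12–4.15] [cite: Kolyvagin1990, Thm. A] -/
theorem residualLambdaFormulaNegDiscAtTwo_rankZero_of_pub
    (hPubG : Summit.BirchSwinnertonDyer.BirchSwinnertonDyer.Theses.ResidualThetaTransportAtTwo.PublishedInputsGreenbergControlAtTwo)
    (hGZK : Summit.BirchSwinnertonDyer.BirchSwinnertonDyer.Theses.ResidualThetaTransportAtTwo.RankEqAnalyticRankLeOne) :
    ∀ (κ : Literature.NumberTheory.EllipticCurves.ZpExtension ℚ 2) (γ : Field.absoluteGaloisGroup ℚ), κ.IsCyclotomic → κ.IsTopGenerator γ → ∀ (S₀ : Finset (IsDedekindDomain.HeightOneSpectrum (NumberField.RingOfIntegers ℚ))), (∀ v ∈ S₀, ((2 : ℕ) : NumberField.RingOfIntegers ℚ) ∉ v.asIdeal) → ∃ c : ℕ, ∀ (E : WeierstrassCurve ℚ) [E.IsElliptic] [E.IsGloballyMinimal], Literature.NumberTheory.EllipticCurves.Rank1Residual.GoodSS E 2 → E.frobeniusTrace 2 = 0 → E.Δ < 0 → E.analyticRank = 0 →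 (∀ v : IsDedekindDomain.HeightOneSpectrum (NumberField.RingOfIntegers ℚ), ¬ E.HasGoodReductionAt v → v ∈ S₀) → ∀ (D : Literature.NumberTheory.EllipticCurves.Kobayashi2003.SignedSelmerDualData E κ γ 1) [Module.Finite (Literature.NumberTheory.EllipticCurves.IwasawaAlgebra 2) D.X], Module.IsTorsion (Literature.NumberTheory.EllipticCurves.IwasawaAlgebra 2) D.X → D.mu = 0 → {x : Literature.NumberTheory.EllipticCurves.subgroupH1 κ.kerSubgroup ↥(AddSubgroup.torsionBy ↥(E.geomPrimaryTorsion 2) (2 : ℤ)) | x ∈ Literature.NumberTheory.EllipticCurves.GreenbergVatsal2000.unramifiedOutside κ.kerSubgroup ↥(AddSubgroup.torsionBy ↥(E.geomPrimaryTorsion 2) (2 : ℤ)) 2 (↑S₀ : Set (IsDedekindDomain.HeightOneSpectrum (NumberField.RingOfIntegers ℚ))) ∧ (∀ (w : NumberField.InfinitePlace ℚ) (σ : Field.absoluteGaloisGroup ℚ), Literature.NumberTheory.EllipticCurves.conjH1 κ.kerSubgroup ↥(AddSubgroup.torsionBy ↥(E.geomPrimaryTorsion 2) (2 : ℤ)) σ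 x ∈ Literature.NumberTheory.EllipticCurves.GreenbergSelmer.infKer κ.kerSubgroup ↥(AddSubgroup.torsionBy ↥(E.geomPrimaryTorsion 2) (2 : ℤ)) w) ∧ (∀ (v : IsDedekindDomain.HeightOneSpectrum (NumberField.RingOfIntegers ℚ)), ((2 : ℕ) : NumberField.RingOfIntegers ℚ) ∈ v.asIdeal → ∀ σ : Field.absoluteGaloisGroup ℚ, E.conjH1 2 κ.kerSubgroup σ (Literature.NumberTheory.EllipticCurves.GreenbergVatsal2000.pushH1 κ.kerSubgroup (AddSubgroup.torsionBy ↥(E.geomPrimaryTorsion 2) (2 : ℤ)).subtype (fun _ _ ↦ rfl) x) ∈ Literature.NumberTheory.EllipticCurves.Kobayashi2003.localKummerOverOfEmb E 2 κ.kerSubgroup (Literature.NumberTheory.EllipticCurves.closureEmb (K := ℚ) (v.adicCompletion ℚ)) (⨆ n : ℕ, Literature.NumberTheory.EllipticCurves.Kobayashi2003.signedLocalPoints κ (v.adicCompletion ℚ) E 1 n))}.ncard = 2 ^ (Literature.NumberTheory.EllipticCurves.lambdaInvariant 2 D.X + ∑ v ∈ S₀, 2 ^ padicValNat 2 ((Rat.HeightOneSpectrum.natGenerator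 v ^ 2 - 1) / 8) * Literature.NumberTheory.EllipticCurves.GreenbergVatsal2000.dMultiplicity E 2 v + c) := by
  intro κ γ hκ hγ S₀ hS2
  obtain ⟨hC, h412, hcork, -, hWL⟩ := hPubG
  refine ⟨0, fun E _ _ hss ha hΔ hr hS D _ hX hμ ↦ ?_⟩
  have hSel : Finite (E.selmerGroupPInfty 2) :=
    Summit.BirchSwinnertonDyer.BirchSwinnertonDyer.Theorems.finite_selmerGroupPInfty_two_of_analyticRank_eq_zero E hGZK hr
  simpa only [Nat.add_zero] using
    Summit.BirchSwinnertonDyer.BirchSwinnertonDyer.Theorems.SignedTransportAtTwo.rlf2_of_print4 hC h412 hcork hWL κ γ hκ hγ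
      S₀ hS2 E hss ha hΔ hS hSel D hX hμ

end Summit.BirchSwinnertonDyer.BirchSwinnertonDyer.Theorems.ResidualThetaLayer
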